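import Summits.QuantumFields.BalabanUV.T4Continuum.Support.NE7CubicVertexCurved
import Summits.QuantumFields.BalabanUV.T4Continuum.Support.NE7SegmentPlaquetteGradient
import Summits.QuantumFields.BalabanUV.T4Continuum.Support.NE7SegmentPlaquetteRadius
import HarnessLib

/-!
# NE7MovingCurlGradient — socket `h′` SUPPLIER LINE, stub (S-b)₂ brick 2 (ROAD-G106 §6 «`c_s − c = ∫₀^s 𝒬_{V_r}(X) dr`»): THE TRANSPORTED
# ADJACENT DIFFERENCE OF THE MOVING DRESSED CURL — along the segment `V_s = W·e^{sX}` the `W`-transported adjacent difference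
# `Ad_{W(z,λ)} (d_{V_s}X)(p′) − (d_{V_s}X)(p)` moves from its value at `s = 0` by at most `s·Q₁`,
# `Q₁ = 64α(α₁ + 2(e^α − 1)α) + 960·x·α² + 64(e^α − 1)α²` (`α = ‖X‖_∞`, `α₁` = the COVARIANT GRADIENT letter of `X`, `x` = the plaquette
# radius along the segment), because its `s`-derivative is the transported adjacent difference of the cubic vertex `𝒬_{V_s}(X) = dcurlAt V_s X X`
# (gen 75's `NE7CubicVertexCurved`, moved from the base `W` to the base `V_s`)

Cell `pub-balaban`, rung (B)+1 sub-cell t4, lineage `b2b-balaban-t4-ne7-p1`, generation 107 (CRUX PROVER NE7 #1 = OWNER of BINDER row NE7).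
Memo `t4/b2b-balaban-t4-ne7-p1-g106/ROAD-G106.md` §4 (S-b), §6; sequel memo `…-g107/ROAD-G107.md`.
WHY.  The C¹ slice letter (S-d) that is to deliver (Lip₁ᶜ) + (Höl½ᶜ) for the relative coordinate `X` of the minimiser pair takes as data the
dressed curl `d_W X` AND ITS COVARIANT GRADIENT.  By the reverse curl reading the curl is the plaquette quotient `D` ((S-b)₁, gen 106:
`NE7PlaquetteQuotientGradient`) up to the second-order remainder `E₂ = U′(∂p) − W(∂p) − (d_W X)(p)·W(∂p)`; the Lipschitz letter for `E₂`
(next file, `NE7CurlRemainderGradient`) is a product computation along the segment whose two non-algebraic ingredients are (i) the growth of the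
plaquette-gradient radius (gen 106's Grönwall brick `NE7SegmentPlaquetteGradient`, whose datum `Γ` THIS FILE supplies, §4) and (ii) the motion of the
transported adjacent difference of the curl itself — THIS FILE (§3).
WHAT ([folklore]; 0 def, 0 sorry; any dimension, any `U(n)`).
 * §1 transport tools: `hasDerivAt_Ad_comp`; `norm_Ad_vary_sub_Ad_le` (`‖Ad_{V_s(b)}Y − Ad_{W(b)}Y‖ ≤ 2(e^{|s|α} − 1)‖Y‖`); `covGrad_letter_vary`
   (the covariant gradient letter moves from `W` to `V_s` at cost `2(e^α − 1)α`); `covGrad_letter_backward` (forward ⇒ backward form, the hypothesis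
   shape of `NE7CubicVertexCurved`); `norm_dcurlAt_covDiff_forward_le` (gen 75's CORE in the forward transported form
   `‖Ad_{V(z,λ)}𝒬_V(p′) − 𝒬_V(p)‖ ≤ 64α₀α₁ + 960xα₀²`).
 * §2 **`norm_movingVertex_covDiff_le`** — `‖Ad_{W(z,λ)} 𝒬_{V_s}(p′) − 𝒬_{V_s}(p)‖ ≤ Q₁` for `s ∈ [0,1]`.
 * §3 `hasDerivAt_movingCurl_covDiff`, **`norm_movingCurl_covDiff_sub_le`** (mean value: the `W`-transported adjacent difference of `d_{V_s}X` is within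
   `Q·s` of that of `d_W X`, for any bound `Q` of §2's quantity on `[0,1]`).
 * §4 **`norm_movingCurl_covDiffW_le`** (`≤ ‖∇c‖ + Q`), **`norm_movingCurl_covDiffV_le`** — the datum `Γ` of `NE7SegmentPlaquetteGradient.norm_transPlaq_vary_le`:
   `‖Ad_{V_s(z,λ)} (d_{V_s}X)(p′) − (d_{V_s}X)(p)‖ ≤ ‖Ad_{W(z,λ)} (d_W X)(p′) − (d_W X)(p)‖ + Q + 8α(e^α − 1)`; `_Q₁` forms with §2's explicit `Q₁`.
HONEST FRAMING (page 1): lattice kinematics on OUR objects (`vary`, `curlAt`, `dcurlAt`, `Ad` BY NAME); the letters `α`, `α₁`, `x` are HYPOTHESES; nothing of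
Bałaban's asserted as an axiom; nothing of NE3∕NE7 discharged; spine count = dagwriter∕referees' call; FIXED FINITE T⁴, rung (B)+1 — NOT infinite volume, NOT
mass gap, NOT BetaPertH, NOT Clay.
-/

set_option autoImplicit false

open scoped BigOperators Matrix Matrix.Norms.L2Operator
open Finset NormedSpace Set

namespace Summit.QuantumFields.BalabanUV.T4Continuum.NE7MovingCurlGradient

open Literature.MathematicalPhysics.QuantumFieldTheory.Balaban1983to89
open B7Prop1Explicit B7Prop2Explicit
open T4AveragingDeficitWall hiding Site Plane Plaq Bond
open T4AveragingDeficitNonAbelian (Ad_mul Ad_sub)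
open AveragingDeficitTransport (norm_Ad_of_unitary)
open AveragingDeficitNearIdentity (Ad_one)
open AveragingDeficitPlaqDeriv (vary_isUnitaryCfg)
open NE3HessForm (dcurlAt)
open NE3CurlStability (norm_Ad_sub_Ad_le norm_vary_sub_le_of_sup)
open NE7CubicVertexLetters (bondL1At_le_of_sup)
open NE7ExpansionRemainderCurvedWeak (norm_curlAt_le_bondL1At)
open NE7CubicVertexCurved (norm_dcurlAt_self_sub_Ad_shift_le norm_dcurlAt_self_le)
open NE7SegmentPlaquetteRadius (hasDerivAt_curlAt_vary_at)

noncomputable section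

variable {d : ℕ} {n : Type*} [Fintype n] [DecidableEq n]

/-! ## §1 Transport tools -/

/-- `Ad_w` passes through derivatives: `d∕dt Ad_w f(t) = Ad_w f′(t)`. [folklore] -/
theorem hasDerivAt_Ad_comp (w : (Matrix n n ℂ)ˣ) {f : ℝ → Matrix n n ℂ} {f' : Matrix n n ℂ} {s : ℝ} (h : HasDerivAt f f' s) :
    HasDerivAt (fun t => Ad w (f t)) (Ad w f') s := by
  unfold Ad
  exact (h.const_mul _).mul_const _

/-- Transport by the moving bond variable against transport by the fixed one: `‖Ad_{V_s(b)}Y − Ad_{W(b)}Y‖ ≤ 2(e^{|s|α} − 1)·‖Y‖`. [folklore] -/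
theorem norm_Ad_vary_sub_Ad_le [Nonempty n] {W : Site d → Fin d → (Matrix n n ℂ)ˣ} (hW : IsUnitaryCfg W)
    {X : Site d → Fin d → Matrix n n ℂ} (hX : IsSkewDir X) {α : ℝ} (hXα : ∀ x κ, ‖X x κ‖ ≤ α) (s : ℝ) (y : Site d) (κ : Fin d)
    (Y : Matrix n n ℂ) : ‖Ad (vary W X s y κ) Y - Ad (W y κ) Y‖ ≤ 2 * (Real.exp (|s| * α) - 1) * ‖Y‖ := by
  have h := norm_Ad_sub_Ad_le (hW y κ) (vary_isUnitaryCfg hW hX s y κ) Y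
  have h1 := norm_vary_sub_le_of_sup hW hXα s y κ
  exact h.trans (mul_le_mul_of_nonneg_right (mul_le_mul_of_nonneg_left h1 (by norm_num)) (norm_nonneg _))

/-- **THE COVARIANT GRADIENT LETTER MOVES FROM `W` TO `V_s`**: if `‖Ad_{W(y+e_κ,τ)} X(y+e_τ,κ) − X(y,κ)‖ ≤ α₁` everywhere, then for `s ∈ [0,1]`
`‖Ad_{V_s(y+e_κ,τ)} X(y+e_τ,κ) − X(y,κ)‖ ≤ α₁ + 2(e^α − 1)α`. [folklore] -/
theorem covGrad_letter_vary [Nonempty n] {W : Site d → Fin d → (Matrix n n ℂ)ˣ} (hW : IsUnitaryCfg W)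
    {X : Site d → Fin d → Matrix n n ℂ} (hX : IsSkewDir X) {α α₁ : ℝ} (hXα : ∀ x κ, ‖X x κ‖ ≤ α)
    (hX1 : ∀ (y : Site d) (κ τ : Fin d), ‖Ad (W (y + e κ) τ) (X (y + e τ) κ) - X y κ‖ ≤ α₁) {s : ℝ} (hs : s ∈ Icc (0 : ℝ) 1)
    (y : Site d) (κ τ : Fin d) : ‖Ad (vary W X s (y + e κ) τ) (X (y + e τ) κ) - X y κ‖ ≤ α₁ + 2 * (Real.exp α - 1) * α := by
  have hα0 : 0 ≤ α := (norm_nonneg _).trans (hXα y κ)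
  have h1 := norm_Ad_vary_sub_Ad_le hW hX hXα s (y + e κ) τ (X (y + e τ) κ)
  rw [abs_of_nonneg hs.1] at h1
  have hexp : Real.exp (s * α) - 1 ≤ Real.exp α - 1 := by
    have := Real.exp_le_exp.mpr (show s * α ≤ α by nlinarith [hs.2])
    linarith
  have hexp0 : 0 ≤ Real.exp α - 1 := by linarith [Real.add_one_le_exp α]
  have h2 : ‖Ad (vary W X s (y + e κ) τ) (X (y + e τ) κ) - Ad (W (y + e κ) τ) (X (y + e τ) κ)‖ ≤ 2 * (Real.exp α - 1) * α :=
    h1.trans (mul_le_mul (mul_le_mul_of_nonneg_left hexp (by norm_num)) (hXα _ _) (norm_nonneg _) (by positivity))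
  calc ‖Ad (vary W X s (y + e κ) τ) (X (y + e τ) κ) - X y κ‖
      = ‖(Ad (vary W X s (y + e κ) τ) (X (y + e τ) κ) - Ad (W (y + e κ) τ) (X (y + e τ) κ))
          + (Ad (W (y + e κ) τ) (X (y + e τ) κ) - X y κ)‖ := by congr 1; abel
    _ ≤ ‖Ad (vary W X s (y + e κ) τ) (X (y + e τ) κ) - Ad (W (y + e κ) τ) (X (y + e τ) κ)‖
          + ‖Ad (W (y + e κ) τ) (X (y + e τ) κ) - X y κ‖ := norm_add_le _ _
    _ ≤ 2 * (Real.exp α - 1) * α + α₁ := add_le_add h2 (hX1 y κ τ)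
    _ = α₁ + 2 * (Real.exp α - 1) * α := by ring

/-- **FORWARD ⇒ BACKWARD FORM** of the covariant gradient letter (the hypothesis shape of `NE7CubicVertexCurved`): for unitary `V`,
`‖Ad_{V(y+e_κ,τ)} A(y+e_τ,κ) − A(y,κ)‖ ≤ α₁` everywhere ⟹ `‖A(y,κ) − Ad_{V(y+e_κ−e_τ,τ)⁻¹} A(y−e_τ,κ)‖ ≤ α₁` everywhere. [folklore] -/
theorem covGrad_letter_backward {V : Site d → Fin d → (Matrix n n ℂ)ˣ} (hV : IsUnitaryCfg V) {A : Site d → Fin d → Matrix n n ℂ} {α₁ : ℝ}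
    (hA1 : ∀ (y : Site d) (κ τ : Fin d), ‖Ad (V (y + e κ) τ) (A (y + e τ) κ) - A y κ‖ ≤ α₁) (y : Site d) (κ τ : Fin d) :
    ‖A y κ - Ad (V (y + e κ - e τ) τ)⁻¹ (A (y - e τ) κ)‖ ≤ α₁ := by
  have h := hA1 (y - e τ) κ τ
  rw [sub_add_cancel] at h
  have e1 : y + e κ - e τ = y - e τ + e κ := by abel
  rw [e1]
  set u : (Matrix n n ℂ)ˣ := V (y - e τ + e κ) τ with hu
  have huU : u ∈ unitaryUnits (Matrix n n ℂ) := hV _ _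
  calc ‖A y κ - Ad u⁻¹ (A (y - e τ) κ)‖ = ‖Ad u (A y κ - Ad u⁻¹ (A (y - e τ) κ))‖ := (norm_Ad_of_unitary huU _).symm
    _ = ‖Ad u (A y κ) - A (y - e τ) κ‖ := by rw [Ad_sub, ← Ad_mul, mul_inv_cancel, Ad_one]
    _ ≤ α₁ := h

/-- **GEN 75's CORE IN THE FORWARD TRANSPORTED FORM**: for unitary `V` with `SmallField V x` (`x ≥ 0`), `‖A‖ ≤ α₀` and the forward covariant gradient
letter `α₁`: `‖Ad_{V(z,λ)} 𝒬_V(A)(z+e_λ;μ,ν) − 𝒬_V(A)(z;μ,ν)‖ ≤ 64α₀α₁ + 960·x·α₀²`. [folklore] -/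
theorem norm_dcurlAt_covDiff_forward_le [Nonempty n] {V : Site d → Fin d → (Matrix n n ℂ)ˣ} (hV : IsUnitaryCfg V) {x : ℝ} (hx : 0 ≤ x)
    (hVx : SmallField V x) {A : Site d → Fin d → Matrix n n ℂ} {α₀ α₁ : ℝ} (hA : ∀ y κ, ‖A y κ‖ ≤ α₀)
    (hA1 : ∀ (y : Site d) (κ τ : Fin d), ‖Ad (V (y + e κ) τ) (A (y + e τ) κ) - A y κ‖ ≤ α₁) (z : Site d) (lam μ ν : Fin d) :
    ‖Ad (V z lam) (dcurlAt V A A (z + e lam) μ ν) - dcurlAt V A A z μ ν‖ ≤ 64 * α₀ * α₁ + 960 * x * α₀ ^ 2 := by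
  have h := norm_dcurlAt_self_sub_Ad_shift_le hV hx hVx hA (covGrad_letter_backward hV hA1) (z + e lam) μ ν lam
  simp only [add_sub_cancel_right] at h
  set u : (Matrix n n ℂ)ˣ := V z lam with hu
  have huU : u ∈ unitaryUnits (Matrix n n ℂ) := hV _ _
  calc ‖Ad u (dcurlAt V A A (z + e lam) μ ν) - dcurlAt V A A z μ ν‖
      = ‖Ad u (dcurlAt V A A (z + e lam) μ ν - Ad u⁻¹ (dcurlAt V A A z μ ν))‖ := by
        rw [Ad_sub, ← Ad_mul, mul_inv_cancel, Ad_one]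
    _ = ‖dcurlAt V A A (z + e lam) μ ν - Ad u⁻¹ (dcurlAt V A A z μ ν)‖ := norm_Ad_of_unitary huU _
    _ ≤ 64 * α₀ * α₁ + 960 * x * α₀ ^ 2 := h

/-! ## §2 The cubic vertex along the segment, transported by the FIXED bond variable -/

/-- **THE MOVING CUBIC VERTEX, `W`-TRANSPORTED.**  `W` unitary, `X` skew with `‖X‖ ≤ α` and forward covariant gradient letter `α₁` (w.r.t. `W`); the
segment stays small-field, `SmallField V_s x` for `s ∈ [0,1]` (`x ≥ 0`).  Then for every `s ∈ [0,1]`: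
`‖Ad_{W(z,λ)} 𝒬_{V_s}(X)(p′) − 𝒬_{V_s}(X)(p)‖ ≤ 64α(α₁ + 2(e^α − 1)α) + 960·x·α² + 64(e^α − 1)α²` (`p′ = p + e_λ`). [folklore] -/
theorem norm_movingVertex_covDiff_le [Nonempty n] {W : Site d → Fin d → (Matrix n n ℂ)ˣ} (hW : IsUnitaryCfg W)
    {X : Site d → Fin d → Matrix n n ℂ} (hX : IsSkewDir X) {α α₁ x : ℝ} (hXα : ∀ x κ, ‖X x κ‖ ≤ α)
    (hX1 : ∀ (y : Site d) (κ τ : Fin d), ‖Ad (W (y + e κ) τ) (X (y + e τ) κ) - X y κ‖ ≤ α₁) (hx : 0 ≤ x)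
    (hxs : ∀ s ∈ Icc (0 : ℝ) 1, SmallField (vary W X s) x) (z : Site d) (lam μ ν : Fin d) {s : ℝ} (hs : s ∈ Icc (0 : ℝ) 1) :
    ‖Ad (W z lam) (dcurlAt (vary W X s) X X (z + e lam) μ ν) - dcurlAt (vary W X s) X X z μ ν‖
      ≤ 64 * α * (α₁ + 2 * (Real.exp α - 1) * α) + 960 * x * α ^ 2 + 64 * (Real.exp α - 1) * α ^ 2 := by
  set V := vary W X s with hV
  have hVu : IsUnitaryCfg V := vary_isUnitaryCfg hW hX s
  have hα0 : 0 ≤ α := (norm_nonneg _).trans (hXα z lam)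
  have hexp0 : 0 ≤ Real.exp α - 1 := by linarith [Real.add_one_le_exp α]
  -- the core at the base `V_s`
  have hcore := norm_dcurlAt_covDiff_forward_le hVu hx (hxs s hs) hXα (covGrad_letter_vary hW hX hXα hX1 hs) z lam μ ν
  -- the transport change `Ad_{V_s(z,λ)} → Ad_{W(z,λ)}`
  have hQ : ‖dcurlAt V X X (z + e lam) μ ν‖ ≤ 32 * α ^ 2 := norm_dcurlAt_self_le hVu hXα _ _ _
  have htr := norm_Ad_vary_sub_Ad_le hW hX hXα s z lam (dcurlAt V X X (z + e lam) μ ν)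
  rw [abs_of_nonneg hs.1] at htr
  have hexp : Real.exp (s * α) - 1 ≤ Real.exp α - 1 := by
    have := Real.exp_le_exp.mpr (show s * α ≤ α by nlinarith [hs.2])
    linarith
  have htr' : ‖Ad (vary W X s z lam) (dcurlAt V X X (z + e lam) μ ν) - Ad (W z lam) (dcurlAt V X X (z + e lam) μ ν)‖
      ≤ 2 * (Real.exp α - 1) * (32 * α ^ 2) :=
    htr.trans (mul_le_mul (mul_le_mul_of_nonneg_left hexp (by norm_num)) hQ (norm_nonneg _) (by positivity))
  calc ‖Ad (W z lam) (dcurlAt V X X (z + e lam) μ ν) - dcurlAt V X X z μ ν‖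
      = ‖(Ad (V z lam) (dcurlAt V X X (z + e lam) μ ν) - dcurlAt V X X z μ ν)
          - (Ad (vary W X s z lam) (dcurlAt V X X (z + e lam) μ ν) - Ad (W z lam) (dcurlAt V X X (z + e lam) μ ν))‖ := by
        rw [hV]; congr 1; abel
    _ ≤ ‖Ad (V z lam) (dcurlAt V X X (z + e lam) μ ν) - dcurlAt V X X z μ ν‖
          + ‖Ad (vary W X s z lam) (dcurlAt V X X (z + e lam) μ ν) - Ad (W z lam) (dcurlAt V X X (z + e lam) μ ν)‖ := norm_sub_le _ _
    _ ≤ (64 * α * (α₁ + 2 * (Real.exp α - 1) * α) + 960 * x * α ^ 2) + 2 * (Real.exp α - 1) * (32 * α ^ 2) := add_le_add hcore htr'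
    _ = 64 * α * (α₁ + 2 * (Real.exp α - 1) * α) + 960 * x * α ^ 2 + 64 * (Real.exp α - 1) * α ^ 2 := by ring

/-! ## §3 Mean value: the transported adjacent difference of the moving curl -/

/-- The `s`-derivative of `Ad_{W(z,λ)} (d_{V_s}X)(p′) − (d_{V_s}X)(p)` is `Ad_{W(z,λ)} 𝒬_{V_s}(X)(p′) − 𝒬_{V_s}(X)(p)`. [folklore] -/
theorem hasDerivAt_movingCurl_covDiff (W : Site d → Fin d → (Matrix n n ℂ)ˣ) (X : Site d → Fin d → Matrix n n ℂ) (z : Site d)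
    (lam μ ν : Fin d) (s : ℝ) :
    HasDerivAt (fun t : ℝ => Ad (W z lam) (curlAt (vary W X t) X (z + e lam) μ ν) - curlAt (vary W X t) X z μ ν)
      (Ad (W z lam) (dcurlAt (vary W X s) X X (z + e lam) μ ν) - dcurlAt (vary W X s) X X z μ ν) s :=
  (hasDerivAt_Ad_comp (W z lam) (hasDerivAt_curlAt_vary_at W X X (z + e lam) μ ν s)).sub (hasDerivAt_curlAt_vary_at W X X z μ ν s)

/-- **MEAN VALUE ALONG THE SEGMENT**: if `‖Ad_{W(z,λ)} 𝒬_{V_s}(p′) − 𝒬_{V_s}(p)‖ ≤ Q` on `[0,1]`, then for `s ∈ [0,1]` the `W`-transported adjacent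
difference of the moving curl is within `Q·s` of that of `d_W X`:
`‖(Ad_{W(z,λ)} (d_{V_s}X)(p′) − (d_{V_s}X)(p)) − (Ad_{W(z,λ)} (d_W X)(p′) − (d_W X)(p))‖ ≤ Q·s`. [folklore] -/
theorem norm_movingCurl_covDiff_sub_le (W : Site d → Fin d → (Matrix n n ℂ)ˣ) (X : Site d → Fin d → Matrix n n ℂ) (z : Site d)
    (lam μ ν : Fin d) {Q : ℝ}
    (hQ : ∀ s ∈ Icc (0 : ℝ) 1, ‖Ad (W z lam) (dcurlAt (vary W X s) X X (z + e lam) μ ν) - dcurlAt (vary W X s) X X z μ ν‖ ≤ Q)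
    {s : ℝ} (hs : s ∈ Icc (0 : ℝ) 1) :
    ‖(Ad (W z lam) (curlAt (vary W X s) X (z + e lam) μ ν) - curlAt (vary W X s) X z μ ν)
        - (Ad (W z lam) (curlAt W X (z + e lam) μ ν) - curlAt W X z μ ν)‖ ≤ Q * s := by
  set G : ℝ → Matrix n n ℂ := fun t => Ad (W z lam) (curlAt (vary W X t) X (z + e lam) μ ν) - curlAt (vary W X t) X z μ ν with hG
  have hderiv : ∀ t ∈ Icc (0 : ℝ) 1, HasDerivWithinAt G
      (Ad (W z lam) (dcurlAt (vary W X t) X X (z + e lam) μ ν) - dcurlAt (vary W X t) X X z μ ν) (Icc (0 : ℝ) 1) t :=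
    fun t _ => (hasDerivAt_movingCurl_covDiff W X z lam μ ν t).hasDerivWithinAt
  have hbound : ∀ t ∈ Ico (0 : ℝ) 1, ‖Ad (W z lam) (dcurlAt (vary W X t) X X (z + e lam) μ ν) - dcurlAt (vary W X t) X X z μ ν‖ ≤ Q :=
    fun t ht => hQ t ⟨ht.1, ht.2.le⟩
  have hmv := norm_image_sub_le_of_norm_deriv_le_segment' hderiv hbound s hs
  have e0 : G 0 = Ad (W z lam) (curlAt W X (z + e lam) μ ν) - curlAt W X z μ ν := by simp only [hG, vary_zero]
  rw [e0, sub_zero] at hmv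
  exact hmv

/-! ## §4 Consequences: the two transported differences of the moving curl -/

/-- **THE `W`-TRANSPORTED ADJACENT DIFFERENCE OF THE MOVING CURL**: `‖Ad_{W(z,λ)} (d_{V_s}X)(p′) − (d_{V_s}X)(p)‖ ≤ ‖Ad_{W(z,λ)} (d_W X)(p′) − (d_W X)(p)‖ + Q`
for `s ∈ [0,1]`. [folklore] -/
theorem norm_movingCurl_covDiffW_le (W : Site d → Fin d → (Matrix n n ℂ)ˣ) (X : Site d → Fin d → Matrix n n ℂ) (z : Site d)
    (lam μ ν : Fin d) {Q : ℝ}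
    (hQ : ∀ s ∈ Icc (0 : ℝ) 1, ‖Ad (W z lam) (dcurlAt (vary W X s) X X (z + e lam) μ ν) - dcurlAt (vary W X s) X X z μ ν‖ ≤ Q)
    {s : ℝ} (hs : s ∈ Icc (0 : ℝ) 1) :
    ‖Ad (W z lam) (curlAt (vary W X s) X (z + e lam) μ ν) - curlAt (vary W X s) X z μ ν‖
      ≤ ‖Ad (W z lam) (curlAt W X (z + e lam) μ ν) - curlAt W X z μ ν‖ + Q := by
  have h := norm_movingCurl_covDiff_sub_le W X z lam μ ν hQ hs
  have hQ0 : 0 ≤ Q := (norm_nonneg _).trans (hQ 0 (left_mem_Icc.mpr zero_le_one))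
  have hQs : Q * s ≤ Q := by nlinarith [hs.1, hs.2]
  set a := Ad (W z lam) (curlAt (vary W X s) X (z + e lam) μ ν) - curlAt (vary W X s) X z μ ν
  set b := Ad (W z lam) (curlAt W X (z + e lam) μ ν) - curlAt W X z μ ν
  calc ‖a‖ = ‖b + (a - b)‖ := by congr 1; abel
    _ ≤ ‖b‖ + ‖a - b‖ := norm_add_le _ _
    _ ≤ ‖b‖ + Q := by linarith

/-- **THE `V_s`-TRANSPORTED ADJACENT DIFFERENCE OF THE MOVING CURL** — the datum `Γ` of `NE7SegmentPlaquetteGradient.norm_transPlaq_vary_le`: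
`‖Ad_{V_s(z,λ)} (d_{V_s}X)(p′) − (d_{V_s}X)(p)‖ ≤ ‖Ad_{W(z,λ)} (d_W X)(p′) − (d_W X)(p)‖ + Q + 8α(e^α − 1)` for `s ∈ [0,1]`
(the transport change costs `2(e^{sα} − 1)·‖d_{V_s}X‖ ≤ 2(e^α − 1)·4α`). [folklore] -/
theorem norm_movingCurl_covDiffV_le [Nonempty n] {W : Site d → Fin d → (Matrix n n ℂ)ˣ} (hW : IsUnitaryCfg W)
    {X : Site d → Fin d → Matrix n n ℂ} (hX : IsSkewDir X) {α : ℝ} (hXα : ∀ x κ, ‖X x κ‖ ≤ α) (z : Site d) (lam μ ν : Fin d) {Q : ℝ}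
    (hQ : ∀ s ∈ Icc (0 : ℝ) 1, ‖Ad (W z lam) (dcurlAt (vary W X s) X X (z + e lam) μ ν) - dcurlAt (vary W X s) X X z μ ν‖ ≤ Q)
    {s : ℝ} (hs : s ∈ Icc (0 : ℝ) 1) :
    ‖Ad (vary W X s z lam) (curlAt (vary W X s) X (z + e lam) μ ν) - curlAt (vary W X s) X z μ ν‖
      ≤ ‖Ad (W z lam) (curlAt W X (z + e lam) μ ν) - curlAt W X z μ ν‖ + Q + 8 * α * (Real.exp α - 1) := by
  have hVu : IsUnitaryCfg (vary W X s) := vary_isUnitaryCfg hW hX s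
  have hα0 : 0 ≤ α := (norm_nonneg _).trans (hXα z lam)
  have hexp0 : 0 ≤ Real.exp α - 1 := by linarith [Real.add_one_le_exp α]
  have h1 := norm_movingCurl_covDiffW_le W X z lam μ ν hQ hs
  have hc : ‖curlAt (vary W X s) X (z + e lam) μ ν‖ ≤ 4 * α :=
    (norm_curlAt_le_bondL1At hVu X _ _ _).trans (bondL1At_le_of_sup hXα _ _ _)
  have htr := norm_Ad_vary_sub_Ad_le hW hX hXα s z lam (curlAt (vary W X s) X (z + e lam) μ ν)
  rw [abs_of_nonneg hs.1] at htr
  have hexp : Real.exp (s * α) - 1 ≤ Real.exp α - 1 := by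
    have := Real.exp_le_exp.mpr (show s * α ≤ α by nlinarith [hs.2])
    linarith
  have htr' : ‖Ad (vary W X s z lam) (curlAt (vary W X s) X (z + e lam) μ ν) - Ad (W z lam) (curlAt (vary W X s) X (z + e lam) μ ν)‖
      ≤ 2 * (Real.exp α - 1) * (4 * α) :=
    htr.trans (mul_le_mul (mul_le_mul_of_nonneg_left hexp (by norm_num)) hc (norm_nonneg _) (by positivity))
  set a := Ad (vary W X s z lam) (curlAt (vary W X s) X (z + e lam) μ ν)
  set b := Ad (W z lam) (curlAt (vary W X s) X (z + e lam) μ ν)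
  set c := curlAt (vary W X s) X z μ ν
  calc ‖a - c‖ = ‖(b - c) + (a - b)‖ := by congr 1; abel
    _ ≤ ‖b - c‖ + ‖a - b‖ := norm_add_le _ _
    _ ≤ (‖Ad (W z lam) (curlAt W X (z + e lam) μ ν) - curlAt W X z μ ν‖ + Q) + 2 * (Real.exp α - 1) * (4 * α) := add_le_add h1 htr'
    _ = ‖Ad (W z lam) (curlAt W X (z + e lam) μ ν) - curlAt W X z μ ν‖ + Q + 8 * α * (Real.exp α - 1) := by ring

/-- **THE SAME WITH §2's EXPLICIT `Q₁`** (the form the next file consumes): under the hypotheses of `norm_movingVertex_covDiff_le`, for `s ∈ [0,1]`,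
(i) `‖(Ad_W (d_{V_s}X)(p′) − (d_{V_s}X)(p)) − (Ad_W (d_W X)(p′) − (d_W X)(p))‖ ≤ Q₁·s`, (ii) `‖Ad_{V_s} (d_{V_s}X)(p′) − (d_{V_s}X)(p)‖ ≤ ‖∇c‖ + Q₁ + 8α(e^α − 1)`,
`Q₁ = 64α(α₁ + 2(e^α − 1)α) + 960xα² + 64(e^α − 1)α²`. [folklore] -/
theorem norm_movingCurl_covDiff_Q₁ [Nonempty n] {W : Site d → Fin d → (Matrix n n ℂ)ˣ} (hW : IsUnitaryCfg W)
    {X : Site d → Fin d → Matrix n n ℂ} (hX : IsSkewDir X) {α α₁ x : ℝ} (hXα : ∀ x κ, ‖X x κ‖ ≤ α)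
    (hX1 : ∀ (y : Site d) (κ τ : Fin d), ‖Ad (W (y + e κ) τ) (X (y + e τ) κ) - X y κ‖ ≤ α₁) (hx : 0 ≤ x)
    (hxs : ∀ s ∈ Icc (0 : ℝ) 1, SmallField (vary W X s) x) (z : Site d) (lam μ ν : Fin d) {s : ℝ} (hs : s ∈ Icc (0 : ℝ) 1) :
    ‖(Ad (W z lam) (curlAt (vary W X s) X (z + e lam) μ ν) - curlAt (vary W X s) X z μ ν)
        - (Ad (W z lam) (curlAt W X (z + e lam) μ ν) - curlAt W X z μ ν)‖
      ≤ (64 * α * (α₁ + 2 * (Real.exp α - 1) * α) + 960 * x * α ^ 2 + 64 * (Real.exp α - 1) * α ^ 2) * s ∧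
    ‖Ad (vary W X s z lam) (curlAt (vary W X s) X (z + e lam) μ ν) - curlAt (vary W X s) X z μ ν‖
      ≤ ‖Ad (W z lam) (curlAt W X (z + e lam) μ ν) - curlAt W X z μ ν‖
        + (64 * α * (α₁ + 2 * (Real.exp α - 1) * α) + 960 * x * α ^ 2 + 64 * (Real.exp α - 1) * α ^ 2) + 8 * α * (Real.exp α - 1) := by
  have hQ : ∀ r ∈ Icc (0 : ℝ) 1, ‖Ad (W z lam) (dcurlAt (vary W X r) X X (z + e lam) μ ν) - dcurlAt (vary W X r) X X z μ ν‖
      ≤ 64 * α * (α₁ + 2 * (Real.exp α - 1) * α) + 960 * x * α ^ 2 + 64 * (Real.exp α - 1) * α ^ 2 :=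
    fun r hr => norm_movingVertex_covDiff_le hW hX hXα hX1 hx hxs z lam μ ν hr
  exact ⟨norm_movingCurl_covDiff_sub_le W X z lam μ ν hQ hs, norm_movingCurl_covDiffV_le hW hX hXα z lam μ ν hQ hs⟩

end

end Summit.QuantumFields.BalabanUV.T4Continuum.NE7MovingCurlGradient
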